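import Mathlib
import HarnessLib
import Summits.NavierStokesRegularity.NavierStokesRegularity.Theorems.PlaneStrainDoorMostTimesSpaceTimeDoor
import Summits.NavierStokesRegularity.NavierStokesRegularity.Theorems.PlaneStrainDoorProfileWindowToSlab
import Summits.NavierStokesRegularity.NavierStokesRegularity.Theorems.LocalTraceTubeDoorTarget
import Summits.NavierStokesRegularity.NavierStokesRegularity.Theorems.LocalTiltingFreeDoorTarget

/-!
# The one-window door family — MOST-TIMES versions of three more doors: S14 «trace square» (harmonic pressure),
# S16′ «plane strain» (Betchov invariant), S19 «tilting-free» (modulo its profile crux K2)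

Instances of the two most-times templates (time class: `…LocalSineTubeDoorMostTimesGenericDoor.mostTimesGenericDoor_of_profileWindowRigidity`,
seat p6 g6; space–time class: `…PlaneStrainDoorMostTimesSpaceTimeDoor.mostTimesSpaceTimeDoor_of_profileWindowRigidity`, this gen)
with PROVED all-slices profile cruxes.  In each: a classical Leray–Hopf flow on `[0,T)` from rapidly decaying data, LOCALLY
Type I at `(x₀,T)` (time rate for S14, space–time for S16′/S19), `U` nonempty open, an exceptional time set `E` with
`|E ∩ (T−h,T)| ≤ εh` for all small `h` (every `ε > 0`), and the scale-normalised window scalar fading in `L¹(U)` along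
EVERY sequence `tₖ → T` in `[0,T) ∖ E` ⇒ `IsBackwardBoundedAt u T x₀`:

* `mostTimesTraceSquareDoor` — scalar `(T−t)² tr((Du)²) = −(T−t)²Δp` (crux `…LocalTraceTubeDoorProfileRigidity.traceSquareWindowRigidity`,
  p519994): the MOST-TIMES strengthening of the CLOSED rung N0-LocalTubeDoorTraceSquare (`…LocalTraceTubeDoorTarget.target`);
* `mostTimesPlaneStrainDoor` — Betchov's invariant `(T−t)³ det(∇u + ∇uᵀ)` (crux
  `…PlaneStrainDoorProfileWindowToSlab.planeStrainProfileRigidity`, p511231): the MOST-TIMES strengthening of the CLOSED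
  door S16′ `…PlaneStrainDoorTargets.target_planeStrain`;
* `mostTimesTiltingDoor_of_tiltingFreeProfileRigidity` — the vortex-tilting norm `(T−t)³‖ω × (∇u)ω‖` of door S19
  (`…LocalTiltingFreeDoorTarget.target_of_tiltingFreeProfileRigidity`), MODULO the text of its open crux K2
  `TiltingFreeProfileRigidity` (nsreg-p1 `r18/Sketch19.lean`), given as the hypothesis.

(The production-free door S16 already has a most-times form under the weaker local TIME Type-I hypothesis:
`…LocalSineTubeDoorMostTimesAllSlicesDoors.mostTimesEnstrophyProductionDoor`.)

Seat nsreg-p6 g10 (THEOREMS-ONLY door sequels, DIRECTOR-NS g8 #32 (2)/#36).  WHAT THIS IS NOT: not NS regularity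
(Clay A) — LOCAL regularity CRITERIA conditional on local Type I (and, for S19, on its open crux); no route is opened.
-/

noncomputable section

-- the summit and its single sub-problem share the name (CONVENTIONS §1), as in every Theorems file
set_option linter.dupNamespace false

namespace Summit.NavierStokesRegularity.NavierStokesRegularity.Theorems.PlaneStrainDoorMostTimesDoors

open MeasureTheory Set Function Filter Topology Metric
open scoped RealInnerProductSpace InnerProductSpace NNReal ENNReal
open Literature.Analysis Literature.Analysis.FluidPDE
open Summit.NavierStokesRegularity.NavierStokesRegularity.Theorems.LocalSineTubeDoorMostTimesGenericDoor (mostTimesGenericDoor_of_profileWindowRigidity)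
open Summit.NavierStokesRegularity.NavierStokesRegularity.Theorems.PlaneStrainDoorMostTimesSpaceTimeDoor (mostTimesSpaceTimeDoor_of_profileWindowRigidity)
open Summit.NavierStokesRegularity.NavierStokesRegularity.Theorems.PlaneStrainDoorZoomSpaceTimeDecay (continuous_strainDet strainDet_zeroSetInvariant)
open Summit.NavierStokesRegularity.NavierStokesRegularity.Theorems.PlaneStrainDoorProfileWindowToSlab (planeStrainProfileRigidity)
open Summit.NavierStokesRegularity.NavierStokesRegularity.Theorems.LocalTraceTubeDoorTarget (trace_smul_comp_smul continuous_traceSq traceSq_zeroSet_invariant)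
open Summit.NavierStokesRegularity.NavierStokesRegularity.Theorems.LocalTraceTubeDoorProfileRigidity (traceSquareWindowRigidity)
open Summit.NavierStokesRegularity.NavierStokesRegularity.Theorems.LocalTiltingFreeDoorTarget (continuous_tiltingNorm tiltingNorm_zeroSetInvariant)

/-- **MOST-TIMES TRACE-SQUARE DOOR (S14).**  Local TIME Type I at `(x₀,T)` and `(T−t)² tr((Du)²)(t, x₀ + √(T−t)y)` fading
in `L¹` on one nonempty open window along every sequence of times outside an exceptional set of density `→ 0` at `T`
⇒ backward bounded at `x₀`. -/
theorem mostTimesTraceSquareDoor :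
    ∀ (ν T : ℝ), 0 < ν → 0 < T → ∀ (u : ℝ → EuclideanSpace ℝ (Fin 3) → EuclideanSpace ℝ (Fin 3))
      (p : ℝ → EuclideanSpace ℝ (Fin 3) → ℝ),
    Literature.Analysis.FluidPDE.IsClassicalNSSolutionOn (Set.Ico 0 T) ν 0 u p →
    Literature.Analysis.FluidPDE.IsLerayHopfOn T ν 0 (u 0) u →
    Literature.Analysis.FluidPDE.HasRapidSpatialDecay (u 0) →
    ∀ (x₀ : EuclideanSpace ℝ (Fin 3)) (ρ M : ℝ), 0 < ρ →
    (∀ t ∈ Set.Ico 0 T, T - ρ ^ 2 < t → ∀ x ∈ Metric.ball x₀ ρ, ‖u t x‖ * Real.sqrt (ν * (T - t)) ≤ M) →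
    ∀ (U : Set (EuclideanSpace ℝ (Fin 3))), IsOpen U → U.Nonempty →
    ∀ (E : Set ℝ), (∀ ε > 0, ∀ᶠ h in nhdsWithin (0 : ℝ) (Set.Ioi 0),
      MeasureTheory.volume (E ∩ Set.Ioo (T - h) T) ≤ ENNReal.ofReal (ε * h)) →
    (∀ t : ℕ → ℝ, (∀ k, t k ∈ Set.Ico 0 T ∧ t k ∉ E) → Filter.Tendsto t Filter.atTop (nhds T) →
      Filter.Tendsto (fun k => ∫⁻ y in U, ENNReal.ofReal
        |(T - t k) ^ 2 * LinearMap.trace ℝ (EuclideanSpace ℝ (Fin 3))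
          (((fderiv ℝ (u (t k)) (x₀ + Real.sqrt (T - t k) • y)).comp
            (fderiv ℝ (u (t k)) (x₀ + Real.sqrt (T - t k) • y))) :
              EuclideanSpace ℝ (Fin 3) →ₗ[ℝ] EuclideanSpace ℝ (Fin 3))|)
        Filter.atTop (nhds 0)) →
    Literature.Analysis.FluidPDE.IsBackwardBoundedAt u T x₀ := by
  intro ν T hν hT u p hsol hLH hdec x₀ ρ M hρ hM U hU hUne E hE hfadeE
  refine mostTimesGenericDoor_of_profileWindowRigidity
    (fun (_ : EuclideanSpace ℝ (Fin 3)) (A : EuclideanSpace ℝ (Fin 3) →L[ℝ] EuclideanSpace ℝ (Fin 3)) =>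
      LinearMap.trace ℝ (EuclideanSpace ℝ (Fin 3))
        ((A.comp A : EuclideanSpace ℝ (Fin 3) →L[ℝ] EuclideanSpace ℝ (Fin 3)) :
          EuclideanSpace ℝ (Fin 3) →ₗ[ℝ] EuclideanSpace ℝ (Fin 3)))
    continuous_traceSq traceSq_zeroSet_invariant
    (fun C v hrate hcont hmild hdiv hwin => traceSquareWindowRigidity C v hrate hcont hmild hdiv hwin)
    ν T hν hT u p hsol hLH hdec x₀ ρ M hρ hM U hU hUne E hE fun t ht hT' => ?_
  refine (hfadeE t ht hT').congr fun k => ?_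
  refine lintegral_congr fun y => ?_
  have hs : 0 ≤ T - t k := (sub_pos.2 (ht k).1.2).le
  congr 2
  rw [trace_smul_comp_smul, ← pow_mul, show 2 * 2 = 4 by norm_num]
  congr 1
  rw [show (4 : ℕ) = 2 * 2 by norm_num, pow_mul, Real.sq_sqrt hs]

/-- **MOST-TIMES PLANE-STRAIN DOOR (S16′).**  Local SPACE–TIME Type I at `(x₀,T)` and Betchov's invariant
`(T−t)³ det(∇u + ∇uᵀ)(t, x₀ + √(T−t)y)` fading in `L¹` on one nonempty open window along every sequence of times outside an
exceptional set of density `→ 0` at `T` ⇒ backward bounded at `x₀`. -/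
theorem mostTimesPlaneStrainDoor :
    ∀ (ν T : ℝ), 0 < ν → 0 < T → ∀ (u : ℝ → EuclideanSpace ℝ (Fin 3) → EuclideanSpace ℝ (Fin 3))
      (p : ℝ → EuclideanSpace ℝ (Fin 3) → ℝ),
    Literature.Analysis.FluidPDE.IsClassicalNSSolutionOn (Set.Ico 0 T) ν 0 u p →
    Literature.Analysis.FluidPDE.IsLerayHopfOn T ν 0 (u 0) u →
    Literature.Analysis.FluidPDE.HasRapidSpatialDecay (u 0) →
    ∀ (x₀ : EuclideanSpace ℝ (Fin 3)) (ρ M : ℝ), 0 < ρ →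
    (∀ t ∈ Set.Ico 0 T, T - ρ ^ 2 < t → ∀ x ∈ Metric.ball x₀ ρ,
        ‖u t x‖ * (‖x - x₀‖ + Real.sqrt (ν * (T - t))) ≤ M) →
    ∀ (U : Set (EuclideanSpace ℝ (Fin 3))), IsOpen U → U.Nonempty →
    ∀ (E : Set ℝ), (∀ ε > 0, ∀ᶠ h in nhdsWithin (0 : ℝ) (Set.Ioi 0),
      MeasureTheory.volume (E ∩ Set.Ioo (T - h) T) ≤ ENNReal.ofReal (ε * h)) →
    (∀ t : ℕ → ℝ, (∀ k, t k ∈ Set.Ico 0 T ∧ t k ∉ E) → Filter.Tendsto t Filter.atTop (nhds T) →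
      Filter.Tendsto (fun k => ∫⁻ y in U, ENNReal.ofReal
        |((Real.sqrt (T - t k) ^ 2 • fderiv ℝ (u (t k)) (x₀ + Real.sqrt (T - t k) • y)) +
          ContinuousLinearMap.adjoint (Real.sqrt (T - t k) ^ 2 • fderiv ℝ (u (t k)) (x₀ + Real.sqrt (T - t k) • y))).det|)
        Filter.atTop (nhds 0)) →
    Literature.Analysis.FluidPDE.IsBackwardBoundedAt u T x₀ :=
  mostTimesSpaceTimeDoor_of_profileWindowRigidity
    (fun (_ : EuclideanSpace ℝ (Fin 3)) (A : EuclideanSpace ℝ (Fin 3) →L[ℝ] EuclideanSpace ℝ (Fin 3)) => (A + ContinuousLinearMap.adjoint A).det)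
    continuous_strainDet strainDet_zeroSetInvariant planeStrainProfileRigidity

/-- **MOST-TIMES TILTING DOOR (S19) modulo its profile crux.**  If tilting-free door-class profiles are never
backward-singular (text of K2 `TiltingFreeProfileRigidity`, nsreg-p1 `r18/Sketch19.lean`, verbatim, as the hypothesis), then:
local SPACE–TIME Type I at `(x₀,T)` and the scale-normalised vortex tilting `(T−t)³‖ω × (∇u)ω‖(t, x₀ + √(T−t)y)` fading in
`L¹` on one nonempty open window along every sequence of times outside an exceptional set of density `→ 0` at `T`
⇒ backward bounded at `x₀`. -/
theorem mostTimesTiltingDoor_of_tiltingFreeProfileRigidity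
    (hK2 : ∀ (C D : ℝ) (v : ℝ → EuclideanSpace ℝ (Fin 3) → EuclideanSpace ℝ (Fin 3)), Literature.Analysis.FluidPDE.HasTypeITimeDecay C v → Literature.Analysis.FluidPDE.HasTypeIDecay D v → ContinuousOn (Function.uncurry v) (Set.Iio (0 : ℝ) ×ˢ Set.univ) → (∀ s t : ℝ, s < t → t < 0 → ∀ x, v t x = Literature.Analysis.UnboundedOperators.heatExtension (v s) (t - s) x - Literature.Analysis.FluidPDE.oseenDuhamel 1 s v v t x) → (∀ t < 0, Literature.Analysis.FluidPDE.VectorCalculus.IsDivFree (v t)) → (∀ s < 0, ∃ U : Set (EuclideanSpace ℝ (Fin 3)), IsOpen U ∧ U.Nonempty ∧ ∀ z ∈ U, Literature.Analysis.FluidPDE.cross (Literature.Analysis.FluidPDE.curlCLM (fderiv ℝ (v s) z)) ((fderiv ℝ (v s) z) (Literature.Analysis.FluidPDE.curlCLM (fderiv ℝ (v s) z))) = 0) → ¬ Literature.Analysis.FluidPDE.IsBackwardSingularPoint v 0) :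
    ∀ (ν T : ℝ), 0 < ν → 0 < T → ∀ (u : ℝ → EuclideanSpace ℝ (Fin 3) → EuclideanSpace ℝ (Fin 3))
      (p : ℝ → EuclideanSpace ℝ (Fin 3) → ℝ),
    Literature.Analysis.FluidPDE.IsClassicalNSSolutionOn (Set.Ico 0 T) ν 0 u p →
    Literature.Analysis.FluidPDE.IsLerayHopfOn T ν 0 (u 0) u →
    Literature.Analysis.FluidPDE.HasRapidSpatialDecay (u 0) →
    ∀ (x₀ : EuclideanSpace ℝ (Fin 3)) (ρ M : ℝ), 0 < ρ →
    (∀ t ∈ Set.Ico 0 T, T - ρ ^ 2 < t → ∀ x ∈ Metric.ball x₀ ρ,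
        ‖u t x‖ * (‖x - x₀‖ + Real.sqrt (ν * (T - t))) ≤ M) →
    ∀ (U : Set (EuclideanSpace ℝ (Fin 3))), IsOpen U → U.Nonempty →
    ∀ (E : Set ℝ), (∀ ε > 0, ∀ᶠ h in nhdsWithin (0 : ℝ) (Set.Ioi 0),
      MeasureTheory.volume (E ∩ Set.Ioo (T - h) T) ≤ ENNReal.ofReal (ε * h)) →
    (∀ t : ℕ → ℝ, (∀ k, t k ∈ Set.Ico 0 T ∧ t k ∉ E) → Filter.Tendsto t Filter.atTop (nhds T) →
      Filter.Tendsto (fun k => ∫⁻ y in U, ENNReal.ofReal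
        ‖Literature.Analysis.FluidPDE.cross
          (Literature.Analysis.FluidPDE.curlCLM (Real.sqrt (T - t k) ^ 2 • fderiv ℝ (u (t k)) (x₀ + Real.sqrt (T - t k) • y)))
          ((Real.sqrt (T - t k) ^ 2 • fderiv ℝ (u (t k)) (x₀ + Real.sqrt (T - t k) • y))
            (Literature.Analysis.FluidPDE.curlCLM (Real.sqrt (T - t k) ^ 2 • fderiv ℝ (u (t k)) (x₀ + Real.sqrt (T - t k) • y))))‖)
        Filter.atTop (nhds 0)) →
    Literature.Analysis.FluidPDE.IsBackwardBoundedAt u T x₀ := by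
  intro ν T hν hT u p hsol hLH hdec x₀ ρ M hρ hM U hU hUne E hE hfadeE
  refine mostTimesSpaceTimeDoor_of_profileWindowRigidity
    (fun (_ : EuclideanSpace ℝ (Fin 3)) (B : EuclideanSpace ℝ (Fin 3) →L[ℝ] EuclideanSpace ℝ (Fin 3)) => ‖cross (curlCLM B) (B (curlCLM B))‖)
    continuous_tiltingNorm tiltingNorm_zeroSetInvariant (fun C D v hrate hdecay hcont hmild hdiv hwin => ?_)
    ν T hν hT u p hsol hLH hdec x₀ ρ M hρ hM U hU hUne E hE fun t ht hT' => ?_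
  · refine hK2 C D v hrate hdecay hcont hmild hdiv fun s hs => ?_
    obtain ⟨W, hW, hWne, h⟩ := hwin s hs
    exact ⟨W, hW, hWne, fun z hz => norm_eq_zero.1 (h z hz)⟩
  · simpa only [abs_norm] using hfadeE t ht hT'

end Summit.NavierStokesRegularity.NavierStokesRegularity.Theorems.PlaneStrainDoorMostTimesDoors

end
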